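import Mathlib
import HarnessLib
import Summits.ResolutionOfSingularities.ResolutionOfSingularities.Theorems.WildQuotientsWildQuotientResolutionS1aCobordantTransport
import Summits.ResolutionOfSingularities.ResolutionOfSingularities.Theorems.WildQuotientsWildQuotientResolutionS1aA1Cover

/-!
# S1a — INSTANCE I-2 (a1), MODELS for MOVE 1: `R^w(A) ≅ k[x_none, x′₀, x′₁, x′₂, x′₃]` (Włodarczyk's model through `e : A ≃ k[x]`), with all pins, and the producer chart rings as its localisations

[OURS · L1 W4.5c · lead-1 g12; plan-1 R-F15c (I-2 := MT-a1″), A-KF v1 §2.4, my F13 (B₊(move 1) = k[x₂, x₃, s, X₀, X₁])] — NOT statements of the manuscript;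
counted 0; AI-level work, weaker than expert review. Crux stmt-ResolutionOfSingularities-17941 `CyclicQuotientFourfolds`, line `s1a-logminvertex` (`stub_reachLowerInFX`).

For the abstract a1 datum (`e : A ≃+* k[x₀..x₃]`, centre `f = (e⁻¹x₀, e⁻¹x₁)`, weights `(2,1)`):
* `a1_cobordantAlgebra_eq` — `R^w(k[x]; (x₀, x₁); (2,1)) = R^w(k[x]; (x₀,x₁,x₂,x₃); (2,1,0,0))` (weight-0 absorption);
* ★ `a1ModelEquiv e : R^w(A; f; (2,1)) ≃+* MvPolynomial (Option (Fin 4)) k` (`congr e` ∘ `Subalgebra.equivOfEq` ∘ `affineSpaceEquiv⁻¹`), with PINS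
  `a1ModelEquiv_s` (`s ↦ X none`), `a1ModelEquiv_u'` (`uᵢ′ ↦ X (some i)`, `i = 0, 1`), `a1ModelEquiv_algebraMap` (`e⁻¹ a ↦ subst a`: `xᵢ ↦ X_none^{wᵢ}·X_(some i)`),
  in particular `a1ModelEquiv_algebraMap_symm_X_two/three` (`e⁻¹x₂ ↦ X (some 2)`, `e⁻¹x₃ ↦ X (some 3)`);
* ★ `a1ModelEquiv_coverElement_zero` — the cover element `x₀^{dp}T^{2dp} ↦ X(some 0)^{dp}`; `a1ModelEquiv_coverElement_one` — `N^{2d}T^{2dp} ↦ (∏ⱼ (X(some 1) +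
  j·X(some 0)·X none))^{2d}` — so by `chartRingEquivAway` the two producer chart rings of move 1 are `k[x_none, x′][1/X′₀^{dp}]` and `k[x_none, x′][1/∏^{2d}]`.
-/

set_option linter.dupNamespace false

noncomputable section

open Literature.AlgebraicGeometry.Resolution
open scoped LaurentPolynomial
open MvPolynomial
open Summit.ResolutionOfSingularities.ResolutionOfSingularities.Theorems.WildQuotientResolution.S1.CoarseChart
open Summit.ResolutionOfSingularities.ResolutionOfSingularities.Theorems.WildQuotientResolution.S1.CobordantTransport

namespace Summit.ResolutionOfSingularities.ResolutionOfSingularities.Theorems.WildQuotientResolution.S1.KillCert.A1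

variable {k : Type} [Field k] {A : Type} [CommRing A] (e : A ≃+* MvPolynomial (Fin 4) k)

/-- The weights of the model: `(2, 1, 0, 0)`. -/
theorem a1_weights_apply : (![2, 1, 0, 0] : Fin 4 → ℕ) 0 = 2 ∧ (![2, 1, 0, 0] : Fin 4 → ℕ) 1 = 1 ∧ (![2, 1, 0, 0] : Fin 4 → ℕ) 2 = 0 ∧ (![2, 1, 0, 0] : Fin 4 → ℕ) 3 = 0 :=
  ⟨rfl, rfl, rfl, rfl⟩

/-- **Weight-0 absorption for a1**: the cobordant algebra of the centre `(x₀:2, x₁:1)` on `k[x]` equals Włodarczyk's model algebra with all four coordinates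
`(2, 1, 0, 0)`. -/
theorem a1_cobordantAlgebra_eq :
    cobordantAlgebra (![X 0, X 1] : Fin 2 → MvPolynomial (Fin 4) k) ![2, 1] = cobordantAlgebra (cobordantAlgebra.coord k : Fin 4 → MvPolynomial (Fin 4) k) ![2, 1, 0, 0] := by
  refine cobordantAlgebra_eq_of_generators _ _ _ _ (fun i => ?_) (fun j => ?_)
  · fin_cases i
    · exact Or.inr ⟨0, rfl, rfl⟩
    · exact Or.inr ⟨1, rfl, rfl⟩
  · fin_cases j
    · exact Or.inr ⟨0, rfl, rfl⟩
    · exact Or.inr ⟨1, rfl, rfl⟩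
    · exact Or.inl rfl
    · exact Or.inl rfl

/-- The family through `e`: `e ∘ (e⁻¹ ∘ (x₀, x₁)) = (x₀, x₁)`. -/
theorem a1_comp_symm : (⇑e ∘ (⇑e.symm ∘ ![X 0, X 1] : Fin 2 → A)) = (![X 0, X 1] : Fin 2 → MvPolynomial (Fin 4) k) :=
  funext fun i => e.apply_symm_apply (![X 0, X 1] i)

/-- `R^w(A; e⁻¹(x₀,x₁); (2,1))` transported along `e` IS the model algebra. -/
theorem a1_cobordantAlgebra_comp_eq :
    cobordantAlgebra (⇑e ∘ (⇑e.symm ∘ ![X 0, X 1] : Fin 2 → A)) ![2, 1] = cobordantAlgebra (cobordantAlgebra.coord k : Fin 4 → MvPolynomial (Fin 4) k) ![2, 1, 0, 0] := by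
  rw [a1_comp_symm, a1_cobordantAlgebra_eq]

/-- ★ **The model isomorphism** `R^w(A; e⁻¹(x₀,x₁); (2,1)) ≃+* k[x_none, x′₀, …, x′₃]`. [OURS · L1 W4.5c · (F-T8) models, a1] -/
def a1ModelEquiv : ↥(cobordantAlgebra (⇑e.symm ∘ ![X 0, X 1] : Fin 2 → A) ![2, 1]) ≃+* MvPolynomial (Option (Fin 4)) k :=
  (congr e (⇑e.symm ∘ ![X 0, X 1]) ![2, 1]).trans
    (((Subalgebra.equivOfEq _ _ (a1_cobordantAlgebra_comp_eq e)).toRingEquiv).trans (cobordantAlgebra.affineSpaceEquiv k (![2, 1, 0, 0] : Fin 4 → ℕ)).symm)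

/-- How the model iso is evaluated: through the underlying Laurent polynomial. -/
theorem a1ModelEquiv_apply_eq (z : ↥(cobordantAlgebra (⇑e.symm ∘ ![X 0, X 1] : Fin 2 → A) ![2, 1]))
    (z' : ↥(cobordantAlgebra (cobordantAlgebra.coord k : Fin 4 → MvPolynomial (Fin 4) k) ![2, 1, 0, 0])) (hz : mapT e (z : A[T;T⁻¹]) = (z' : (MvPolynomial (Fin 4) k)[T;T⁻¹])) :
    a1ModelEquiv e z = (cobordantAlgebra.affineSpaceEquiv k (![2, 1, 0, 0] : Fin 4 → ℕ)).symm z' := by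
  change (cobordantAlgebra.affineSpaceEquiv k (![2, 1, 0, 0] : Fin 4 → ℕ)).symm
    ((Subalgebra.equivOfEq _ _ (a1_cobordantAlgebra_comp_eq e)) (congr e (⇑e.symm ∘ ![X 0, X 1]) ![2, 1] z)) = _
  congr 1
  exact Subtype.ext hz

/-- Inverting `affineSpaceEquiv` on a value of `ofAffineSpace`. -/
theorem affineSpaceEquiv_symm_of (F : MvPolynomial (Option (Fin 4)) k) :
    (cobordantAlgebra.affineSpaceEquiv k (![2, 1, 0, 0] : Fin 4 → ℕ)).symm (cobordantAlgebra.ofAffineSpace k ![2, 1, 0, 0] F) = F :=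
  (cobordantAlgebra.affineSpaceEquiv k (![2, 1, 0, 0] : Fin 4 → ℕ)).symm_apply_apply F

/-- PIN: `s ↦ X none`. -/
theorem a1ModelEquiv_s : a1ModelEquiv e (cobordantAlgebra.s _ _) = X none := by
  rw [a1ModelEquiv_apply_eq e _ (cobordantAlgebra.s _ _) (by rw [cobordantAlgebra.coe_s, cobordantAlgebra.coe_s, mapT_T]),
    ← cobordantAlgebra.ofAffineSpace_X_none, affineSpaceEquiv_symm_of]

/-- PIN: `u′₀ = e⁻¹x₀·T² ↦ X (some 0)`. -/
theorem a1ModelEquiv_u'_zero : a1ModelEquiv e (cobordantAlgebra.u' _ _ 0) = X (some 0) := by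
  rw [a1ModelEquiv_apply_eq e _ (cobordantAlgebra.u' _ _ 0) (by rw [cobordantAlgebra.coe_u', cobordantAlgebra.coe_u', mapT_C_mul_T]; simp),
    ← cobordantAlgebra.ofAffineSpace_X_some, affineSpaceEquiv_symm_of]

/-- PIN: `u′₁ = e⁻¹x₁·T ↦ X (some 1)`. -/
theorem a1ModelEquiv_u'_one : a1ModelEquiv e (cobordantAlgebra.u' _ _ 1) = X (some 1) := by
  rw [a1ModelEquiv_apply_eq e _ (cobordantAlgebra.u' _ _ 1) (by rw [cobordantAlgebra.coe_u', cobordantAlgebra.coe_u', mapT_C_mul_T]; simp),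
    ← cobordantAlgebra.ofAffineSpace_X_some, affineSpaceEquiv_symm_of]

/-- PIN: constants `e⁻¹ a ↦ subst a` (`xᵢ ↦ X_none^{wᵢ} · X_(some i)`). -/
theorem a1ModelEquiv_algebraMap (a : MvPolynomial (Fin 4) k) :
    a1ModelEquiv e (algebraMap A _ (e.symm a)) = cobordantAlgebra.subst k (![2, 1, 0, 0] : Fin 4 → ℕ) a := by
  rw [a1ModelEquiv_apply_eq e _ (algebraMap (MvPolynomial (Fin 4) k) _ a)
      (by rw [cobordantAlgebra.coe_algebraMap, cobordantAlgebra.coe_algebraMap, mapT_C, e.apply_symm_apply]),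
    cobordantAlgebra.algebraMap_eq_ofAffineSpace_subst, affineSpaceEquiv_symm_of]

/-- PIN: `e⁻¹x₂ ↦ X (some 2)` (weight 0). -/
theorem a1ModelEquiv_algebraMap_symm_X_two : a1ModelEquiv e (algebraMap A _ (e.symm (X 2))) = X (some 2) := by
  rw [a1ModelEquiv_algebraMap, cobordantAlgebra.subst, MvPolynomial.eval₂Hom_X']
  simp

/-- PIN: `e⁻¹x₃ ↦ X (some 3)` (weight 0). -/
theorem a1ModelEquiv_algebraMap_symm_X_three : a1ModelEquiv e (algebraMap A _ (e.symm (X 3))) = X (some 3) := by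
  rw [a1ModelEquiv_algebraMap, cobordantAlgebra.subst, MvPolynomial.eval₂Hom_X']
  simp

/-- PIN: `e⁻¹x₀ ↦ X_none² · X (some 0)` and `e⁻¹x₁ ↦ X_none · X (some 1)` (the local equations `xᵢ = s^{wᵢ} xᵢ′`). -/
theorem a1ModelEquiv_algebraMap_symm_X_zero_one :
    a1ModelEquiv e (algebraMap A _ (e.symm (X 0))) = X none ^ 2 * X (some 0) ∧ a1ModelEquiv e (algebraMap A _ (e.symm (X 1))) = X none * X (some 1) := by
  constructor
  · rw [a1ModelEquiv_algebraMap, cobordantAlgebra.subst, MvPolynomial.eval₂Hom_X']; simp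
  · rw [a1ModelEquiv_algebraMap, cobordantAlgebra.subst, MvPolynomial.eval₂Hom_X']; simp

/-! ## The cover elements in the model -/

section Cover

variable {m : ℕ} (r : Fin m → ℕ) (𝒜 : (Π j : Fin m, ZMod (r j)) → AddSubgroup A) [GradedRing 𝒜] {p : ℕ}

/-- ★ **Cover element 0 in the model**: for `y` with `(y : A) = (e⁻¹x₀)^{dp}` and `dbar = 2dp`, `yT^{dbar} ↦ X(some 0)^{dp}`. -/
theorem a1ModelEquiv_coverElement_zero (d : ℕ) {dbar : ℕ} (hdbar : dbar = d * (2 * p)) (y : ↥(𝒜 0))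
    (hyval : (y : A) = e.symm (X 0) ^ (d * p)) (hy : y ∈ (traceFiltration 𝒜 (⇑e.symm ∘ ![X 0, X 1] : Fin 2 → A) ![2, 1]).ideal dbar) :
    a1ModelEquiv e (coverElement 𝒜 (⇑e.symm ∘ ![X 0, X 1] : Fin 2 → A) ![2, 1] dbar y hy) = X (some 0) ^ (d * p) := by
  have h : coverElement 𝒜 (⇑e.symm ∘ ![X 0, X 1] : Fin 2 → A) ![2, 1] dbar y hy = cobordantAlgebra.u' (⇑e.symm ∘ ![X 0, X 1] : Fin 2 → A) ![2, 1] 0 ^ (d * p) := by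
    refine Subtype.ext ?_
    rw [coe_coverElement, SubmonoidClass.coe_pow, cobordantAlgebra.coe_u', hyval, hdbar]
    change _ = (LaurentPolynomial.C (e.symm (X 0)) * LaurentPolynomial.T ((2 : ℕ) : ℤ)) ^ (d * p)
    rw [mul_pow, map_pow, LaurentPolynomial.T_pow]
    congr 2
    push_cast
    ring
  rw [h, map_pow, a1ModelEquiv_u'_zero]

/-- ★ **Cover element 1 in the model**: for `y` with `(y : A) = N^{2d}`, `N = ∏_{j : ZMod p} (e⁻¹x₁ + j·e⁻¹x₀)`, and `dbar = 2dp`: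
`yT^{dbar} ↦ (∏ⱼ (X(some 1) + j·(X(some 0)·X none)))^{2d}`. -/
theorem a1ModelEquiv_coverElement_one [NeZero p] (d : ℕ) {dbar : ℕ} (hdbar : dbar = d * (2 * p)) (y : ↥(𝒜 0))
    (hyval : (y : A) = (∏ i : ZMod p, (e.symm (X 1) + (i.val : A) * e.symm (X 0))) ^ (2 * d))
    (hy : y ∈ (traceFiltration 𝒜 (⇑e.symm ∘ ![X 0, X 1] : Fin 2 → A) ![2, 1]).ideal dbar) :
    a1ModelEquiv e (coverElement 𝒜 (⇑e.symm ∘ ![X 0, X 1] : Fin 2 → A) ![2, 1] dbar y hy) =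
      (∏ j : ZMod p, (X (some 1) + C (j.val : k) * (X (some 0) * X none))) ^ (2 * d) := by
  set X₁ := cobordantAlgebra.u' (⇑e.symm ∘ ![X 0, X 1] : Fin 2 → A) ![2, 1] 0 with hX₁def
  set X₂ := cobordantAlgebra.u' (⇑e.symm ∘ ![X 0, X 1] : Fin 2 → A) ![2, 1] 1 with hX₂def
  set s := cobordantAlgebra.s (⇑e.symm ∘ ![X 0, X 1] : Fin 2 → A) ![2, 1] with hsdef
  have h : coverElement 𝒜 (⇑e.symm ∘ ![X 0, X 1] : Fin 2 → A) ![2, 1] dbar y hy = (∏ j : ZMod p, (X₂ + algebraMap A _ (j.val : A) * (X₁ * s))) ^ (2 * d) := by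
    refine Subtype.ext ?_
    rw [coe_coverElement, SubmonoidClass.coe_pow, SubmonoidClass.coe_finsetProd, hyval, hdbar]
    have hj : ∀ j : ZMod p, ((X₂ + algebraMap A _ (j.val : A) * (X₁ * s) : ↥(cobordantAlgebra (⇑e.symm ∘ ![X 0, X 1] : Fin 2 → A) ![2, 1])) : A[T;T⁻¹]) =
        LaurentPolynomial.C (e.symm (X 1)) * LaurentPolynomial.T 1 +
          (j.val : A[T;T⁻¹]) * (LaurentPolynomial.C (e.symm (X 0)) * LaurentPolynomial.T 2 * LaurentPolynomial.T (-1)) := by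
      intro j
      rw [AddMemClass.coe_add, MulMemClass.coe_mul, MulMemClass.coe_mul, hX₂def, hX₁def, hsdef, cobordantAlgebra.coe_u', cobordantAlgebra.coe_u',
        cobordantAlgebra.coe_s, cobordantAlgebra.coe_algebraMap, map_natCast]
      rfl
    simp_rw [hj]
    rw [← a1_norm_T e (p := p), mul_pow, ← map_pow, LaurentPolynomial.T_pow]
    congr 2
    push_cast
    ring
  rw [h, map_pow, map_prod]
  congr 1
  refine Finset.prod_congr rfl fun j _ => ?_
  have hc : a1ModelEquiv e (algebraMap A (↥(cobordantAlgebra (⇑e.symm ∘ ![X 0, X 1] : Fin 2 → A) ![2, 1])) (j.val : A)) = C (j.val : k) := by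
    rw [map_natCast, map_natCast, map_natCast]
  rw [map_add, map_mul, map_mul, hX₂def, hX₁def, hsdef, a1ModelEquiv_u'_one, a1ModelEquiv_u'_zero, a1ModelEquiv_s, hc]

end Cover

end Summit.ResolutionOfSingularities.ResolutionOfSingularities.Theorems.WildQuotientResolution.S1.KillCert.A1

end
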